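import Mathlib
import Summits.NavierStokesRegularity.NavierStokesRegularity.Theses.TypeIQuarterGate
import Summits.NavierStokesRegularity.NavierStokesRegularity.Theorems.GaldiLiouvilleGateRecordZoomAncientStubTaoRep
import Summits.NavierStokesRegularity.NavierStokesRegularity.Theorems.GaldiLiouvilleGateRecordZoomAncientStubEnstrophyPersistence
import Summits.NavierStokesRegularity.NavierStokesRegularity.Theorems.GaldiLiouvilleGateRecordZoomAncientStubTypeIBranch
import Summits.NavierStokesRegularity.NavierStokesRegularity.Theorems.GaldiLiouvilleGateRecordZoomAncientStubZoomBound
import Summits.NavierStokesRegularity.NavierStokesRegularity.Theorems.GaldiLiouvilleGateRecordZoomAncientStubZoomLimit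
import Summits.NavierStokesRegularity.NavierStokesRegularity.Theorems.GaldiLiouvilleGateRecordZoomAncientOfKernel
import Literature.Analysis.FluidPDE.TaoClassGlue
import Literature.Analysis.FluidPDE.NSLerayBlowupRateTopHolds
import Literature.Analysis.FluidPDE.TaoEnstrophyLocalisationProofs
import HarnessLib

/-!
# `TypeIQuarterGate`: THE QUARTER ZOOM KEEPS THE TYPE-I CLOCK — the Galdi back end
# `ParabolicGaldiLiouville` ⟨0893⟩ can be replaced by a Type-I-clock Liouville statement

Helper file for the cruxes `QuarterLawTypeI` (stmt-NavierStokesRegularity-23726) and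
`ParabolicGaldiLiouville` (stmt-NavierStokesRegularity-0893) of route `TypeIQuarterGate`
(theorems only, no new definitions). The route closes `NavierStokesRegularity` from
`QuarterLawTypeI ∧ QuarterZoom ∧ ParabolicGaldiLiouville ∧ NoTypeII`; the support `QuarterZoom`
(item 23727, proved) produces a NONTRIVIAL bounded ancient mild solution `v` with slice enstrophy
`≤ 1` and `L⁶` slices, which X2 = `ParabolicGaldiLiouville` kills; X2 contains Galdi's steady
`D`-solution Liouville problem (item 0895, open in print). The zoom limit carries MORE structure
than X2 consumes: under `NoTypeII` the blow-up is velocity-Type-I, `‖u(t,x)‖ ≤ C_I/√(T−t)` near `T`,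
so the enstrophy-normalised zooms `z_n(s,y) = (ν/L_n) u(t_n + ν³s/L_n², x_n + ν²y/L_n)` of the
record-zoom line obey, for fixed `s < 0` and large `n`, `√(−s)‖z_n(s,y)‖ ≤ √(−s)νB/L_n + C_I/√ν`
(`B` a velocity bound on an initial closed slab, `L_n → ∞`), because
`T − (t_n + ν³s/L_n²) ≥ ν³(−s)/L_n²`; pointwise convergence (`stub_zoomLimit`) passes it to `v`.

* `typeIQuarterGate_quarterZoom_typeIClock` — `NoTypeII → QuarterLawTypeI →` the zoom limit of a
  non-extendable solution is a nontrivial bounded ancient mild solution (`ν = 1`), smooth, slice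
  enstrophy `≤ 1`, `L⁶` slices, AND `√(−s)‖v(s,y)‖ ≤ C'` for all `s < 0`, `y` (KNSS currency).
* Companion file `TypeIQuarterGateTypeIClockLiouvilleLinks`: `QuarterLawTypeI → NoTypeII → TQAL →
  NavierStokesRegularity` with TQAL = X2 plus the EXTRA clock hypothesis; X2 ⟹ TQAL; the bare
  Type-I-rate Liouville statement ⟹ TQAL; steady fields obeying the clock vanish (Galdi's problem
  0895 ⊆ X2 is NOT contained in TQAL). The route's residual weakens from X2 to TQAL by name.

HONEST FRAMING: conditional statements about HYPOTHETICAL blow-ups; TQAL is open (same kind as the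
exclusion of Type-I blow-up); nothing here proves a crux or bears on Navier–Stokes regularity.
References: Koch–Nadirashvili–Seregin–Šverák, Acta Math. 203 (2009), Thm 1.2, §6; Leray 1934 §20.
-/

noncomputable section

set_option linter.dupNamespace false

namespace Summit.NavierStokesRegularity.NavierStokesRegularity.Theorems

open Set MeasureTheory Filter Topology Function
open scoped ENNReal NNReal
open Literature.Analysis.FluidPDE
open RecordZoomAncient.Birth

namespace QuarterZoomTypeIClock

/-- Square-root bookkeeping: if `ν³ (−s) ≤ L² d` with `ν, L, d > 0`, `s < 0`, then
`√(−s) · ν · √ν ≤ L · √d`. -/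
theorem sqrt_neg_mul_le {ν L d s : ℝ} (hν : 0 < ν) (hL : 0 < L) (hd : 0 < d) (hs : s < 0)
    (h : ν ^ 3 * (-s) ≤ L ^ 2 * d) :
    Real.sqrt (-s) * ν * Real.sqrt ν ≤ L * Real.sqrt d := by
  have hs' : 0 ≤ -s := neg_nonneg.2 hs.le
  have e1 : (Real.sqrt (-s) * ν * Real.sqrt ν) ^ 2 = ν ^ 3 * (-s) := by
    rw [mul_pow, mul_pow, Real.sq_sqrt hs', Real.sq_sqrt hν.le]; ring
  have e2 : (L * Real.sqrt d) ^ 2 = L ^ 2 * d := by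
    rw [mul_pow, Real.sq_sqrt hd.le]
  have ha : 0 ≤ Real.sqrt (-s) * ν * Real.sqrt ν := by positivity
  have hb : 0 ≤ L * Real.sqrt d := by positivity
  calc Real.sqrt (-s) * ν * Real.sqrt ν
      = Real.sqrt ((Real.sqrt (-s) * ν * Real.sqrt ν) ^ 2) := (Real.sqrt_sq ha).symm
    _ ≤ Real.sqrt ((L * Real.sqrt d) ^ 2) := Real.sqrt_le_sqrt (by rw [e1, e2]; exact h)
    _ = L * Real.sqrt d := Real.sqrt_sq hb

/-- The one-zoom estimate. For a field `u` on `[0,T)` with `‖u(t,x)‖ ≤ B + C/√(T−t)` (`C ≥ 0`),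
a base time `tc < T`, a level `L > 0` with `ν³(−s) ≤ tc·L²` and `s < 0`, the zoom value
`z = (ν/L) u(tc + ν³s/L², X)` obeys `√(−s)‖z‖ ≤ √(−s)·(νB/L) + C/√ν` (only `C ≥ 0` is used). -/
theorem zoom_clock_bound {ν T B C tc L s : ℝ}
    {u : ℝ → EuclideanSpace ℝ (Fin 3) → EuclideanSpace ℝ (Fin 3)}
    (hν : 0 < ν) (hC : 0 ≤ C) (htcT : tc < T) (hL : 0 < L) (hs : s < 0)
    (hpast : ν ^ 3 * (-s) ≤ tc * L ^ 2)
    (hglob : ∀ t ∈ Set.Ico 0 T, ∀ x, ‖u t x‖ ≤ B + C / Real.sqrt (T - t))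
    (X : EuclideanSpace ℝ (Fin 3)) :
    Real.sqrt (-s) * ‖(ν / L) • u (tc + ν ^ 3 / L ^ 2 * s) X‖ ≤
      Real.sqrt (-s) * (ν * B / L) + C / Real.sqrt ν := by
  set τ : ℝ := tc + ν ^ 3 / L ^ 2 * s with hτ
  have hL2 : 0 < L ^ 2 := pow_pos hL 2
  have hν3 : 0 < ν ^ 3 := pow_pos hν 3
  have hs' : 0 < -s := neg_pos.2 hs
  have hshift : ν ^ 3 / L ^ 2 * s = -(ν ^ 3 * (-s) / L ^ 2) := by ring
  have hτ0 : 0 ≤ τ := by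
    rw [hτ, hshift]
    have h1 : ν ^ 3 * (-s) / L ^ 2 ≤ tc := by
      rw [div_le_iff₀ hL2]; exact hpast
    linarith
  have hneg : ν ^ 3 / L ^ 2 * s < 0 := mul_neg_of_pos_of_neg (div_pos hν3 hL2) hs
  have hτT : τ < T := by rw [hτ]; linarith
  have hTτ : 0 < T - τ := sub_pos.2 hτT
  have hkey : ν ^ 3 * (-s) ≤ L ^ 2 * (T - τ) := by
    have hid : L ^ 2 * (T - τ) = L ^ 2 * (T - tc) + ν ^ 3 * (-s) := by
      rw [hτ]; field_simp; ring
    rw [hid]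
    have : 0 ≤ L ^ 2 * (T - tc) := mul_nonneg hL2.le (sub_pos.2 htcT).le
    linarith
  have hu : ‖u τ X‖ ≤ B + C / Real.sqrt (T - τ) := hglob τ ⟨hτ0, hτT⟩ X
  have hnorm : ‖(ν / L) • u τ X‖ = ν / L * ‖u τ X‖ := by
    rw [norm_smul, Real.norm_of_nonneg (div_pos hν hL).le]
  have hνL : 0 ≤ ν / L := (div_pos hν hL).le
  have hsq : 0 < Real.sqrt (T - τ) := Real.sqrt_pos.2 hTτ
  have hsν : 0 < Real.sqrt ν := Real.sqrt_pos.2 hν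
  -- the Type-I part: `√(−s) (ν/L) (C/√(T−τ)) ≤ C/√ν`
  have hratio : Real.sqrt (-s) * ν / (L * Real.sqrt (T - τ)) ≤ 1 / Real.sqrt ν := by
    rw [div_le_div_iff₀ (mul_pos hL hsq) hsν, one_mul]
    exact sqrt_neg_mul_le hν hL hTτ hs hkey
  have hpart : Real.sqrt (-s) * (ν / L * (C / Real.sqrt (T - τ))) ≤ C / Real.sqrt ν := by
    have hid : Real.sqrt (-s) * (ν / L * (C / Real.sqrt (T - τ))) =
        C * (Real.sqrt (-s) * ν / (L * Real.sqrt (T - τ))) := by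
      field_simp
    rw [hid]
    calc C * (Real.sqrt (-s) * ν / (L * Real.sqrt (T - τ)))
        ≤ C * (1 / Real.sqrt ν) := mul_le_mul_of_nonneg_left hratio hC
      _ = C / Real.sqrt ν := by ring
  have hsqs : 0 ≤ Real.sqrt (-s) := Real.sqrt_nonneg _
  calc Real.sqrt (-s) * ‖(ν / L) • u τ X‖
      = Real.sqrt (-s) * (ν / L * ‖u τ X‖) := by rw [hnorm]
    _ ≤ Real.sqrt (-s) * (ν / L * (B + C / Real.sqrt (T - τ))) :=
        mul_le_mul_of_nonneg_left (mul_le_mul_of_nonneg_left hu hνL) hsqs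
    _ = Real.sqrt (-s) * (ν * B / L) + Real.sqrt (-s) * (ν / L * (C / Real.sqrt (T - τ))) := by
        ring
    _ ≤ Real.sqrt (-s) * (ν * B / L) + C / Real.sqrt ν := add_le_add le_rfl hpart

/-- Levels `L_n > 0` with `tc_n · L_n² → ∞` and `tc_n ≤ T` tend to infinity. -/
theorem tendsto_level_atTop {T : ℝ} (hT : 0 < T) {tc L : ℕ → ℝ}
    (htc : ∀ n, 0 < tc n ∧ tc n < T) (hL : ∀ n, 0 < L n)
    (hpast : Tendsto (fun n => tc n * L n ^ 2) atTop atTop) : Tendsto L atTop atTop := by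
  have h2 : Tendsto (fun n => L n ^ 2) atTop atTop := by
    refine tendsto_atTop_mono (fun n => ?_) (hpast.atTop_div_const hT)
    rw [div_le_iff₀ hT]
    have := (htc n).2.le
    nlinarith [pow_pos (hL n) 2]
  refine tendsto_atTop.2 fun M => ?_
  have hm : 0 ≤ max M 0 := le_max_right _ _
  filter_upwards [h2.eventually_ge_atTop ((max M 0) ^ 2 + 1)] with n hn
  have hLn := hL n
  by_contra hlt
  rw [not_le] at hlt
  have hlt' : L n < max M 0 := lt_of_lt_of_le hlt (le_max_left _ _)
  nlinarith [mul_pos (sub_pos.2 hlt') (add_pos_of_nonneg_of_pos hm hLn)]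

end QuarterZoomTypeIClock

open QuarterZoomTypeIClock

/-- **The quarter zoom keeps the Type-I clock.** Under `NoTypeII` and `QuarterLawTypeI`, a
non-extendable classical Leray–Hopf solution from a rapidly decaying datum has a zoom limit `v` which
is a NONTRIVIAL bounded ancient mild solution (`ν = 1`), smooth on `(−∞,0) × ℝ³`, with slice enstrophy
`≤ 1`, `L⁶` slices (the conclusion of `QuarterZoom`, item 23727) AND the Type-I clock
`√(−s)‖v(s,y)‖ ≤ C'` for all `s < 0` and all `y`. Proof: the proof of
`typeIQuarterGate_quarterZoom_proof` (Type-I-enstrophy branch `stub_typeIBranch` of the record-zoom line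
of `GaldiLiouvilleGate`) with the common tail re-run keeping the velocity-Type-I rate of `u`: the zooms
obey `zoom_clock_bound` and converge pointwise (`stub_zoomLimit`).
[cite: KochNadirashviliSereginSverak2009, Thm 1.2 and §6 (Type-I zoom limits)] [cite: Leray1934, §20] -/
theorem typeIQuarterGate_quarterZoom_typeIClock :
    Summit.NavierStokesRegularity.NavierStokesRegularity.Theses.TypeIQuarterGate.NoTypeII →
    Summit.NavierStokesRegularity.NavierStokesRegularity.Theses.TypeIQuarterGate.QuarterLawTypeI →
    ∀ (ν T : ℝ), 0 < ν → 0 < T →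
      ∀ (u : ℝ → EuclideanSpace ℝ (Fin 3) → EuclideanSpace ℝ (Fin 3))
        (p : ℝ → EuclideanSpace ℝ (Fin 3) → ℝ),
        IsClassicalNSSolutionOn (Set.Ico 0 T) ν 0 u p → IsLerayHopfOn T ν 0 (u 0) u →
        HasRapidSpatialDecay (u 0) → ¬ HasSmoothExtensionPast ν 0 u T →
        ∃ v : ℝ → EuclideanSpace ℝ (Fin 3) → EuclideanSpace ℝ (Fin 3),
          IsBoundedAncientMildSolution 1 v ∧
          ContDiffOn ℝ (⊤ : ℕ∞) (Function.uncurry v) (Set.Iio 0 ×ˢ Set.univ) ∧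
          (∀ s < 0, ∫⁻ y, ENNReal.ofReal (frobeniusNormSq (fderiv ℝ (v s) y)) ≤ 1) ∧
          (∀ s < 0, MemLp (v s) 6 volume) ∧ ¬ (∀ s < 0, ∀ y, v s y = 0) ∧
          ∃ C' : ℝ, 0 ≤ C' ∧ ∀ s < 0, ∀ y, Real.sqrt (-s) * ‖v s y‖ ≤ C' := by
  unfold Summit.NavierStokesRegularity.NavierStokesRegularity.Theses.TypeIQuarterGate.NoTypeII
    Summit.NavierStokesRegularity.NavierStokesRegularity.Theses.TypeIQuarterGate.QuarterLawTypeI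
  intro hII hQ ν T hν hT u p hcl hLH hdec hnext
  have hmax : IsMaximalSmoothSolution ν 0 u p T := ⟨hcl, hnext⟩
  have hI : IsTypeIBlowup u T := hII ν T hν hT u p hmax hLH hdec
  obtain ⟨K, hK⟩ := hQ ν T hν hT u p hmax hLH hdec hI
  have hrep : ∀ T' ∈ Set.Ioo 0 T, ∃ P : ℝ → EuclideanSpace ℝ (Fin 3) → ℝ,
      IsTaoSolutionOn T' ν (u 0) u P :=
    stub_taoRep ν T hν hT u p hcl hLH hdec
  obtain ⟨cP, KP, hcP, hKP, hpers⟩ := stub_enstrophyPersistence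
  have hpers' := hpers ν T hν hT u p hcl hrep
  obtain ⟨cL, hcL, hLer⟩ := leray_blowup_rate_top_holds
  have hstrip : ∀ T' ∈ Set.Ioo 0 T,
      eLpNorm (uncurry u) ∞ (volume.restrict (Set.Icc 0 T' ×ˢ univ)) < ∞ := by
    intro T' hT'
    obtain ⟨P, hP⟩ := hrep T' hT'
    obtain ⟨B, -, hB⟩ := hP.exists_bound_velocity
    rw [eLpNorm_exponent_top]
    refine eLpNormEssSup_lt_top_of_ae_bound (C := B) ?_
    filter_upwards [ae_restrict_mem (measurableSet_Icc.prod MeasurableSet.univ)] with w hw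
    obtain ⟨t, x⟩ := w
    exact hB t hw.1 x
  have hrate : ∀ t ∈ Set.Ico 0 T, ∃ x, cL / 2 * Real.sqrt ν / Real.sqrt (T - t) ≤ ‖u t x‖ := by
    intro t ht
    have h := hLer ν T hν hT u p ⟨hcl, hnext⟩ hLH hstrip t ht
    have ha : 0 < cL * Real.sqrt ν / Real.sqrt (T - t) := by
      have h1 : 0 < Real.sqrt ν := Real.sqrt_pos.2 hν
      have h2 : 0 < Real.sqrt (T - t) := Real.sqrt_pos.2 (sub_pos.2 ht.2)
      positivity
    obtain ⟨x, hx⟩ := exists_half_le_norm_of_ofReal_le_eLpNorm_top ha h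
    refine ⟨x, ?_⟩
    have heq : cL / 2 * Real.sqrt ν / Real.sqrt (T - t) =
        cL * Real.sqrt ν / Real.sqrt (T - t) / 2 := by ring
    rw [heq]
    exact hx
  -- (2) the quarter law in Frobenius form: Type-I enstrophy at EVERY time
  set K' : ℝ := max K 1 with hK'
  have hK'0 : 0 < K' := lt_of_lt_of_le one_pos (le_max_right _ _)
  have hsν : 0 < ν * Real.sqrt ν := mul_pos hν (Real.sqrt_pos.2 hν)
  set C : ℝ := K' / (ν * Real.sqrt ν) with hC
  have hC0 : 0 < C := div_pos hK'0 hsν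
  have hCid : ∀ t, C * (ν * Real.sqrt ν) / Real.sqrt (T - t) = K' / Real.sqrt (T - t) := by
    intro t
    rw [hC, div_mul_cancel₀ _ hsν.ne']
  have hfrob : ∀ s ∈ Set.Ico 0 T,
      (∫⁻ x, ENNReal.ofReal (frobeniusNormSq (fderiv ℝ (u s) x))) ≤
        ENNReal.ofReal (K / Real.sqrt (T - s)) := by
    intro s hs
    have hs2 : ContDiff ℝ 2 (u s) := (hcl.contDiff_velocity hs).of_le (by norm_cast)
    have hL2 : ∫⁻ x, ‖u s x‖ₑ ^ 2 < ⊤ := by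
      have hm : MemLp (u s) 2 volume := hLH.memLp s ⟨hs.1, hs.2.le⟩
      have h := lintegral_rpow_enorm_lt_top_of_eLpNorm_lt_top two_ne_zero ENNReal.ofNat_ne_top
        hm.eLpNorm_lt_top
      simpa [ENNReal.toReal_ofNat] using h
    exact (lintegral_frobeniusNormSq_fderiv_le_lintegral_sq_norm_curl hs2 (hcl.divFree s hs)
      hL2).trans (hK s hs)
  have hIII : ∀ t' ∈ Set.Ico 0 T, ∃ t ∈ Set.Ico t' T, ∀ s ∈ Set.Icc 0 t,
      (∫⁻ x, ENNReal.ofReal (frobeniusNormSq (fderiv ℝ (u s) x))) ≤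
        ENNReal.ofReal (C * (ν * Real.sqrt ν) / Real.sqrt (T - t)) := by
    intro t' ht'
    refine ⟨t', ⟨le_rfl, ht'.2⟩, fun s hs => ?_⟩
    have hsT : s ∈ Set.Ico 0 T := ⟨hs.1, hs.2.trans_lt ht'.2⟩
    refine (hfrob s hsT).trans (ENNReal.ofReal_le_ofReal ?_)
    rw [hCid]
    have h1 : 0 < Real.sqrt (T - t') := Real.sqrt_pos.2 (sub_pos.2 ht'.2)
    have h2 : Real.sqrt (T - t') ≤ Real.sqrt (T - s) := Real.sqrt_le_sqrt (by linarith [hs.2])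
    calc K / Real.sqrt (T - s) ≤ K' / Real.sqrt (T - s) :=
          div_le_div_of_nonneg_right (le_max_left _ _) (h1.le.trans h2)
      _ ≤ K' / Real.sqrt (T - t') := div_le_div_of_nonneg_left hK'0.le h1 h2
  -- (3) the Type-I-enstrophy branch: velocity-concentrated enstrophy-normalised zooms
  obtain ⟨tc, xc, L, s₀, θ, hs₀, hθ, htc, hL, hdom, hpast, hconc⟩ :=
    stub_typeIBranch ν T hν hT u p hcl (cL / 2) (by positivity) hrate cP KP hcP hKP hpers' C hC0 hIII
  -- (4) a global velocity bound `B + C_I/√(T−t)` on `[0, T)` from the eventual Type-I rate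
  obtain ⟨CI, hCI⟩ := hI
  obtain ⟨T₁, hT₁T, hIsub⟩ := mem_nhdsLT_iff_exists_Ioo_subset.1 hCI
  set T' : ℝ := max T₁ (T / 2) with hT'
  have hT'mem : T' ∈ Set.Ioo 0 T :=
    ⟨lt_of_lt_of_le (half_pos hT) (le_max_right _ _), max_lt hT₁T (half_lt_self hT)⟩
  obtain ⟨P, hP⟩ := hrep T' hT'mem
  obtain ⟨B, hB0, hB⟩ := hP.exists_bound_velocity
  set CI' : ℝ := max CI 0 with hCI'
  have hCI'0 : 0 ≤ CI' := le_max_right _ _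
  have hglob : ∀ t ∈ Set.Ico 0 T, ∀ x, ‖u t x‖ ≤ B + CI' / Real.sqrt (T - t) := by
    intro t ht x
    have hst : 0 < Real.sqrt (T - t) := Real.sqrt_pos.2 (sub_pos.2 ht.2)
    have hnn : 0 ≤ CI' / Real.sqrt (T - t) := div_nonneg hCI'0 hst.le
    by_cases htT' : t ≤ T'
    · exact (hB t ⟨ht.1, htT'⟩ x).trans (le_add_of_nonneg_right hnn)
    · have htmem : t ∈ Set.Ioo T₁ T := ⟨lt_of_le_of_lt (le_max_left _ _) (not_le.1 htT'), ht.2⟩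
      have h1 : ‖u t x‖ ≤ CI / Real.sqrt (T - t) := hIsub htmem x
      have h2 : CI / Real.sqrt (T - t) ≤ CI' / Real.sqrt (T - t) :=
        div_le_div_of_nonneg_right (le_max_left _ _) hst.le
      exact (h1.trans h2).trans (le_add_of_nonneg_left hB0)
  -- (5) the common tail, re-run: universal bound after one critical unit, zooms, KNSS limit
  obtain ⟨Cz, hCz⟩ := stub_zoomBound
  have hbd : ∀ n, ∀ t ∈ Set.Icc (ν ^ 3 / L n ^ 2) (tc n), ∀ x, ‖u t x‖ ≤ Cz * L n / ν :=
    fun n t ht x => hCz ν T hν hT u p hcl hLH hdec hrep (tc n) (L n) (htc n).1 (htc n).2 (hL n)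
      (hdom n) t ht x
  set z : ℕ → ℝ → EuclideanSpace ℝ (Fin 3) → EuclideanSpace ℝ (Fin 3) :=
    fun n s y => (ν / L n) • u (tc n + ν ^ 3 / L n ^ 2 * s) (xc n + (ν ^ 2 / L n) • y) with hz_def
  have hz : ∀ n s y, z n s y =
      (ν / L n) • u (tc n + ν ^ 3 / L n ^ 2 * s) (xc n + (ν ^ 2 / L n) • y) := fun n s y => rfl
  obtain ⟨φ, v, hφ, hconv, hmild, hsmooth, hens, hL6⟩ :=
    stub_zoomLimit ν T hν hT u p hcl hLH hdec hrep tc xc L htc hL hdom hpast Cz hbd z hz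
  refine ⟨v, hmild, hsmooth, hens, hL6, ?_, ?_⟩
  · -- non-triviality, read off at the rescaled time `s₀` and the origin
    intro hzero
    have hslice0 : v s₀ 0 = 0 := hzero _ hs₀ 0
    have hlim : Tendsto (fun n => ‖z (φ n) s₀ 0‖) atTop (𝓝 0) := by
      have h := (hconv _ hs₀ 0).norm
      rwa [hslice0, norm_zero] at h
    have hlow : ∀ n, θ ≤ ‖z (φ n) s₀ 0‖ := fun n => by
      have h := hconc (φ n)
      simpa only [hz, smul_zero, add_zero] using h
    have hθle : θ ≤ 0 := ge_of_tendsto' hlim hlow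
    linarith
  · -- the Type-I clock passes to the pointwise limit
    refine ⟨CI' / Real.sqrt ν, div_nonneg hCI'0 (Real.sqrt_nonneg _), fun s hs y => ?_⟩
    have hLtop : Tendsto L atTop atTop := tendsto_level_atTop hT htc hL hpast
    have hLφ : Tendsto (fun n => L (φ n)) atTop atTop := hLtop.comp hφ.tendsto_atTop
    have hpastφ : Tendsto (fun n => tc (φ n) * L (φ n) ^ 2) atTop atTop :=
      hpast.comp hφ.tendsto_atTop
    have hzb : ∀ᶠ n in atTop, Real.sqrt (-s) * ‖z (φ n) s y‖ ≤
        Real.sqrt (-s) * (ν * B / L (φ n)) + CI' / Real.sqrt ν := by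
      filter_upwards [hpastφ.eventually_ge_atTop (ν ^ 3 * (-s))] with n hn
      rw [hz]
      exact zoom_clock_bound hν hCI'0 (htc (φ n)).2 (hL (φ n)) hs hn hglob _
    have ha : Tendsto (fun n => Real.sqrt (-s) * ‖z (φ n) s y‖) atTop
        (𝓝 (Real.sqrt (-s) * ‖v s y‖)) :=
      ((hconv s hs y).norm).const_mul _
    have hb : Tendsto (fun n => Real.sqrt (-s) * (ν * B / L (φ n)) + CI' / Real.sqrt ν) atTop
        (𝓝 (Real.sqrt (-s) * 0 + CI' / Real.sqrt ν)) :=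
      ((tendsto_const_nhds.div_atTop hLφ).const_mul _).add tendsto_const_nhds
    rw [mul_zero, zero_add] at hb
    exact le_of_tendsto_of_tendsto ha hb hzb

end Summit.NavierStokesRegularity.NavierStokesRegularity.Theorems

end
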